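import Summits.BirchSwinnertonDyer.BirchSwinnertonDyer.Theorems.RamifiedHeegnerPairLeafRankOneUpperAtThreeOptimalManin
import HarnessLib

/-!
# Route `RamifiedHeegnerPair`, crux U₁ `LeafRankOneUpperAtThree` (stmt-BirchSwinnertonDyer-26022), line `splitkolyvagin` —
# skeleton v4's COMPOSITION: U₁ ⟸ PUB⁺ + S2 + Σ″ + L₀, the Manin clause discharged via the optimal member of the class

HONEST FRAMING. Theorems only; helper file (`--supports stmt-BirchSwinnertonDyer-26022 --as helper`); nothing is booked,
no item is closed, BSD is not proved for any curve; CONDITIONAL on every displayed input. Lead prover bsd-line-rhp-p2 g5,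
2026-08-28. Sibling of `…LeafRankOneUpperAtThreeOptimalManin.lean` (§1 leaf isogeny invariance, §2 the upper half is a
class statement, §3 Manin on the leaf for lattice-optimal data + the optimal member from modularity, §4 U₁ at an optimal
member ⟸ print + S2 + Σ″ + L₀), which this file assembles:

* §5 `leafRankOneUpperAtThree_of_pubManin_of_divisibilityReading_of_sigmaOptOffRows_of_lowerRankZero` — the route decl
  `LeafRankOneUpperAtThree` BY NAME from PUB⁺ (= the registered PUB ∧ Cassels `bsdRHS_eq_of_isIsogenous` ∧ Mazur 1978
  Cor. 4.1 ∧ Abbes–Ullmo 1996 Thm. A ∧ Česnavičius 2018 Thm. 1.2 — named facts, print), S2 (the Jetchev divisibility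
  reading, VERBATIM the potss binder, unchanged), Σ″ (the research residue with NO Manin clause, asked at lattice-optimal
  members off the mono-multiplicative-carrier rows) and L₀ (item 26023 BY NAME): for `W` on the leaf move to the optimal
  member `W₀ ∼ W` (modularity alone), settle U₁ at `W₀` (§4 of the sibling), transport back (Cassels + GZK).
* `leafRankOneUpperAtThree_of_pubManin_of_divisibilityReading_of_sigmaOffRows_of_lowerRankZero` — the reshape LOSES
  NOTHING: v3's research stub Σ′ implies Σ″ (`sigmaOptOffRows_of_sigmaOffRows`), so PUB⁺ + S2 + Σ′ + L₀ also gives U₁.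

EFFECT on the census (g4's CARRIER-SPLIT-g4.md, N ≤ 5·10⁵): the clause «∃ datum with 3 ∤ c», previously DISPLAYED on all
99 r1 (and, for U₀, 190 r0) S2 rows and folded into Σ′ elsewhere ("Edixhoven needs p > 7; Cremona c = 1 is evidence
only"), is now PRINT on the whole leaf. U₁ stays OPEN; BSD is not proved.

References: [cite: Mazur1978, Cor. 4.1] [cite: AbbesUllmo1996, Thm. A] [cite: Cesnavicius2018, Thm. 1.2]
[cite: EdixhovenManin1991, §1 and Prop. 2] [cite: Cassels1965ArithmeticVIII] [cite: MilneADT2006, Thm. I.7.3 and Remark I.7.4]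
[cite: Jetchev2008, Conj. 1.3, Thm. 1.4, Cor. 1.5 (p. 812)] [cite: MatarNekovar2019, Thm. 0.7 (p. 456)]
[cite: FriedbergHoffstein1995, Thm. B] [cite: GrossZagier1986, Thm. I.(6.3) and (7.3)] [cite: Miller2011LMS, §1 and Def. 1.1].
-/

-- D-0017: single-problem summit, so `Summit.BirchSwinnertonDyer.BirchSwinnertonDyer.…` repeats a namespace BY DESIGN.
set_option linter.dupNamespace false
set_option autoImplicit false

noncomputable section

open scoped Classical NumberField

open WeierstrassCurve IsDedekindDomain IsDedekindDomain.HeightOneSpectrum NumberField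
  Rat.HeightOneSpectrum Literature Literature.NumberTheory.EllipticCurves
  Literature.NumberTheory.EllipticCurves.ModularForms
  Literature.NumberTheory.EllipticCurves.Rank1Residual
  Literature.NumberTheory.EllipticCurves.Rank1Residual.Typed
  Literature.NumberTheory.QuadraticFields
  Summit.BirchSwinnertonDyer.Rank1Residual
  Summit.BirchSwinnertonDyer.Rank1Residual.Additive
  Summit.BirchSwinnertonDyer.Rank1Residual.X11b.Three
  Summit.BirchSwinnertonDyer.BirchSwinnertonDyer.Theses.RamifiedHeegnerPair
  Summit.BirchSwinnertonDyer.BirchSwinnertonDyer.Theorems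

namespace Summit.BirchSwinnertonDyer.BirchSwinnertonDyer.Theorems.RamifiedPairUpperBound

/-! ## §5 The reshaped composition of the line (skeleton v4): U₁ ⟸ PUB⁺ + S2 + Σ″ + L₀ -/

/-- **`LeafRankOneUpperAtThree` ⟸ PUB⁺ + S2 + Σ″ + L₀** (conclusion literally the route decl; skeleton v4 of line
`splitkolyvagin`). PUB⁺ = the registered print conjunction PUB ∧ Cassels' isogeny invariance of the BSD quotient ∧ the
three printed prime-by-prime Manin facts (Mazur 1978 Cor. 4.1, Abbes–Ullmo 1996 Thm. A, Česnavičius 2018 Thm. 1.2) — all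
named facts of the tree, print; S2 = the Jetchev divisibility reading (unchanged, VERBATIM the potss binder); Σ″ = the
research residue WITHOUT the Manin clause, asked only at lattice-optimal members off the mono-multiplicative-carrier
rows; L₀ = route item 26023 BY NAME. Proof: move to the optimal member `W₀ ∼ W` of the class (§3
`exists_optimal_leaf_member`: modularity alone; `W₀` is again a non-CM leaf curve of analytic rank one, §1), settle U₁ at
`W₀` by §4, and transport it back along the isogeny by Cassels + GZK (§2). CONDITIONAL on every displayed input; U₁
stays OPEN; BSD is not proved. [cite: Jetchev2008, Conj. 1.3, Thm. 1.4 (p. 812)] [cite: MatarNekovar2019, Thm. 0.7 (p. 456)]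
[cite: Mazur1978, Cor. 4.1] [cite: MilneADT2006, Thm. I.7.3] [cite: EdixhovenManin1991, §1 and Prop. 2]
[cite: FriedbergHoffstein1995, Thm. B] [cite: GrossZagier1986, Thm. I.(6.3) and (7.3)] [cite: Miller2011LMS, Def. 1.1] -/
theorem leafRankOneUpperAtThree_of_pubManin_of_divisibilityReading_of_sigmaOptOffRows_of_lowerRankZero
    (hpub : (∀ (N : ℕ) [NeZero N] (W : WeierstrassCurve ℚ) (K : Type) [Field K] [NumberField K],
        Literature.NumberTheory.EllipticCurves.gross_zagier N W K) ∧
      (∀ (N : ℕ) [NeZero N] (W : WeierstrassCurve ℚ) (K : Type) [Field K] [NumberField K],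
        Literature.NumberTheory.EllipticCurves.kolyvagin N W K) ∧
      Literature.NumberTheory.EllipticCurves.rank_eq_analyticRank_of_analyticRank_le_one ∧
      WeierstrassCurve.hasEntireLFunction_rat ∧
      Literature.NumberTheory.EllipticCurves.GrossZagier1986_thm_I_7_3 ∧
      Literature.NumberTheory.EllipticCurves.MatarNekovar2019.thm07_padicValNat_card_sha_primary_add_le_of_globalDivisibility_of_irreducible ∧
      Literature.NumberTheory.EllipticCurves.ModularForms.exists_isNewformOf ∧
      Literature.NumberTheory.EllipticCurves.friedbergHoffstein_exists_heegnerField_splitDivisors_twist_ne_zero ∧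
      Literature.NumberTheory.EllipticCurves.ModularForms.nonempty_modularParametrizationData ∧
      WeierstrassCurve.bsdRHS_eq_of_isIsogenous ∧
      Literature.NumberTheory.EllipticCurves.ModularForms.mazur_not_dvd_maninConstant_of_odd ∧
      Literature.NumberTheory.EllipticCurves.ModularForms.abbesUllmo_not_dvd_maninConstant_of_not_dvd_level ∧
      Literature.NumberTheory.EllipticCurves.ModularForms.cesnavicius_not_two_dvd_maninConstant_of_two_dvd_level)
    (hD : ∀ (W : WeierstrassCurve ℚ) [W.IsElliptic] [W.IsGloballyMinimal] [NeZero (W.conductorNorm ℤ)],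
      ¬ W.HasCM →
      ∀ (K : Type) [Field K] [NumberField K], Literature.NumberTheory.EllipticCurves.IsImaginaryQuadratic K →
      NumberField.discr K ≠ -3 → NumberField.discr K ≠ -4 →
      Literature.NumberTheory.EllipticCurves.SatisfiesHeegnerHypothesis (W.conductorNorm ℤ) K →
      ∀ (p : ℕ) [Fact p.Prime], p ≠ 2 → Literature.NumberTheory.EllipticCurves.Rank1Residual.Addv W p →
      0 ≤ padicValRat p W.j → W.HasIrreducibleModPGaloisRep p →
      ¬ p ∣ (W.baseChange ℚ_[p]).localTamagawaNumber ℤ_[p] →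
      (∀ (q' : ℕ) [Fact q'.Prime], q' ∣ W.conductorNorm ℤ →
        p ∣ (W.baseChange ℚ_[q']).localTamagawaNumber ℤ_[q'] → ¬ q' ^ 2 ∣ W.conductorNorm ℤ) →
      ∀ (Dt : Literature.NumberTheory.EllipticCurves.ModularForms.ModularParametrizationData W (W.conductorNorm ℤ))
        (β : ℤ) (ι : K →+* ℂ) (d₁ : Literature.NumberTheory.EllipticCurves.KolyvaginHeegnerData Dt β ι 1),
        ¬ IsOfFinAddOrder d₁.derivedPoint →
      ∀ (q : ℕ) [Fact q.Prime], q ∣ W.conductorNorm ℤ → ¬ q ^ 2 ∣ W.conductorNorm ℤ → q ≠ p →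
      ∀ (s : ℕ), s ≤ padicValNat p ((W.baseChange ℚ_[q]).localTamagawaNumber ℤ_[q]) →
      ∀ (n : ℕ) (d : Literature.NumberTheory.EllipticCurves.KolyvaginHeegnerData Dt β ι n), Squarefree n →
        (∀ ℓ ∈ n.primeFactors, Literature.NumberTheory.EllipticCurves.Zhang2014.IsKolyvaginPrime (W.conductorNorm ℤ) W K p ℓ ∧
          s ≤ Literature.NumberTheory.EllipticCurves.Zhang2014.kolyvaginIndex W p ℓ) →
        ∃ Q : (W.baseChange (Literature.NumberTheory.EllipticCurves.ringClassField K ι n)).toAffine.Point,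
          ((p ^ s : ℕ) : ℤ) • Q = d.derivedPoint)
    (hSig : ∀ (W : WeierstrassCurve ℚ) [W.IsElliptic] [W.IsGloballyMinimal] (N : ℕ) [NeZero N]
      (K : Type) [Field K] [NumberField K]
      (Dt : Literature.NumberTheory.EllipticCurves.ModularForms.ModularParametrizationData W N)
      (H : Literature.NumberTheory.EllipticCurves.HeegnerDatum N (NumberField.discr K)) (ι : K →+* ℂ)
      (P : (W.baseChange K).toAffine.Point),
      ¬ W.HasCM → Literature.NumberTheory.EllipticCurves.Rank1Residual.Addv W 3 →
      Summit.BirchSwinnertonDyer.Rank1Residual.Additive.SubGss W 3 → W.analyticRank = 1 →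
      W.conductorNorm ℤ = N →
      (∀ z ∈ Dt.L.lattice, ∃ w ∈ Literature.NumberTheory.EllipticCurves.ModularForms.periodLattice Dt.f, z = Dt.c * w) →
      ¬ ((∃ (q : ℕ) (_ : Fact q.Prime), q ∣ N ∧ ¬ q ^ 2 ∣ N ∧
          padicValNat 3 W.tamagawaProduct ≤ padicValNat 3 ((W.baseChange ℚ_[q]).localTamagawaNumber ℤ_[q])) ∧
        (∀ (q' : ℕ) [Fact q'.Prime], q' ∣ N →
          3 ∣ (W.baseChange ℚ_[q']).localTamagawaNumber ℤ_[q'] → ¬ q' ^ 2 ∣ N)) →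
      Literature.NumberTheory.EllipticCurves.IsImaginaryQuadratic K →
      Literature.NumberTheory.EllipticCurves.SatisfiesHeegnerHypothesis N K →
      (W.quadraticTwist (NumberField.discr K : ℚ)).entireLFunction 1 ≠ 0 →
      (WeierstrassCurve.Affine.Point.map ι.toRatAlgHom) P =
        Literature.NumberTheory.EllipticCurves.ModularForms.heegnerPointComplex Dt H →
      ¬ IsOfFinAddOrder P → Odd (NumberField.discr K) →
      ∀ (s' : ℕ), s' ≤ padicValNat 3 W.tamagawaProduct + padicValNat 3 Dt.c.natAbs →
      ∀ (n : ℕ) (d : Literature.NumberTheory.EllipticCurves.KolyvaginHeegnerData Dt H.β ι n), Squarefree n →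
      (∀ ℓ ∈ n.primeFactors, Literature.NumberTheory.EllipticCurves.Zhang2014.IsKolyvaginPrime N W K 3 ℓ ∧
        s' ≤ Literature.NumberTheory.EllipticCurves.Zhang2014.kolyvaginIndex W 3 ℓ) →
      Summit.BirchSwinnertonDyer.Rank1Residual.X11b.Three.Koly.PDiv d 3 s')
    (hL0 : Summit.BirchSwinnertonDyer.BirchSwinnertonDyer.Theses.RamifiedHeegnerPair.Gss2LowerAtThreeRankZero) :
    Summit.BirchSwinnertonDyer.BirchSwinnertonDyer.Theses.RamifiedHeegnerPair.LeafRankOneUpperAtThree := by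
  intro W _ _ hCM hadd hsub hr
  obtain ⟨hGZ, hKo, hGZK, hmod, hGZ73, hMN, hnf, hFH, -, hCassels, hM, hAU, hC2⟩ := hpub
  haveI : Fact (Nat.Prime 3) := ⟨Nat.prime_three⟩
  obtain ⟨W₀, hW₀, hW₀', N, hN0, D₀, hiso, hN₀, -, hopt, hCM₀, hadd₀, hsub₀, hr₀⟩ :=
    exists_optimal_leaf_member hnf W hCM hadd hsub
  haveI := hW₀
  haveI := hW₀'
  haveI := hN0
  -- settle U₁ at the optimal member `W₀`
  have h₀ : MissingUpperBoundAt W₀ 3 := by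
    subst hN₀
    exact leafRankOneUpper_three_of_latticeOptimal_of_divisibilityReading_of_sigmaOptOffRows_of_lowerRankZero hGZ hKo
      hGZK hmod hGZ73 hMN hnf hFH hM hAU hC2 hD hSig hL0 W₀ hCM₀ hadd₀ hsub₀ (hr₀.trans hr) D₀ hopt
  -- and transport it back along `W ∼ W₀`
  exact missingUpperBoundAt_of_isIsogenous_of_analyticRank_le_one hCassels hGZK hmod (le_of_eq hr) hiso h₀

/-- **The reshape LOSES NOTHING: v3's inputs (+ the four print facts) give the crux through v4's composition** —
PUB⁺ + S2 + Σ′ + L₀ ⟹ `LeafRankOneUpperAtThree`, by `sigmaOptOffRows_of_sigmaOffRows` (Σ′ ⟹ Σ″) and §5. So skeleton v4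
asks for strictly less than v3 on the research side (Σ″ instead of Σ′), at the price of three more PRINTED named facts
(Mazur, Abbes–Ullmo, Česnavičius) and Cassels' invariance in PUB⁺. [cite: Jetchev2008, Conj. 1.3 (p. 812)]
[cite: Mazur1978, Cor. 4.1] [cite: MilneADT2006, Thm. I.7.3] -/
theorem leafRankOneUpperAtThree_of_pubManin_of_divisibilityReading_of_sigmaOffRows_of_lowerRankZero
    (hpub : (∀ (N : ℕ) [NeZero N] (W : WeierstrassCurve ℚ) (K : Type) [Field K] [NumberField K],
        Literature.NumberTheory.EllipticCurves.gross_zagier N W K) ∧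
      (∀ (N : ℕ) [NeZero N] (W : WeierstrassCurve ℚ) (K : Type) [Field K] [NumberField K],
        Literature.NumberTheory.EllipticCurves.kolyvagin N W K) ∧
      Literature.NumberTheory.EllipticCurves.rank_eq_analyticRank_of_analyticRank_le_one ∧
      WeierstrassCurve.hasEntireLFunction_rat ∧
      Literature.NumberTheory.EllipticCurves.GrossZagier1986_thm_I_7_3 ∧
      Literature.NumberTheory.EllipticCurves.MatarNekovar2019.thm07_padicValNat_card_sha_primary_add_le_of_globalDivisibility_of_irreducible ∧
      Literature.NumberTheory.EllipticCurves.ModularForms.exists_isNewformOf ∧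
      Literature.NumberTheory.EllipticCurves.friedbergHoffstein_exists_heegnerField_splitDivisors_twist_ne_zero ∧
      Literature.NumberTheory.EllipticCurves.ModularForms.nonempty_modularParametrizationData ∧
      WeierstrassCurve.bsdRHS_eq_of_isIsogenous ∧
      Literature.NumberTheory.EllipticCurves.ModularForms.mazur_not_dvd_maninConstant_of_odd ∧
      Literature.NumberTheory.EllipticCurves.ModularForms.abbesUllmo_not_dvd_maninConstant_of_not_dvd_level ∧
      Literature.NumberTheory.EllipticCurves.ModularForms.cesnavicius_not_two_dvd_maninConstant_of_two_dvd_level)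
    (hD : ∀ (W : WeierstrassCurve ℚ) [W.IsElliptic] [W.IsGloballyMinimal] [NeZero (W.conductorNorm ℤ)],
      ¬ W.HasCM →
      ∀ (K : Type) [Field K] [NumberField K], Literature.NumberTheory.EllipticCurves.IsImaginaryQuadratic K →
      NumberField.discr K ≠ -3 → NumberField.discr K ≠ -4 →
      Literature.NumberTheory.EllipticCurves.SatisfiesHeegnerHypothesis (W.conductorNorm ℤ) K →
      ∀ (p : ℕ) [Fact p.Prime], p ≠ 2 → Literature.NumberTheory.EllipticCurves.Rank1Residual.Addv W p →
      0 ≤ padicValRat p W.j → W.HasIrreducibleModPGaloisRep p →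
      ¬ p ∣ (W.baseChange ℚ_[p]).localTamagawaNumber ℤ_[p] →
      (∀ (q' : ℕ) [Fact q'.Prime], q' ∣ W.conductorNorm ℤ →
        p ∣ (W.baseChange ℚ_[q']).localTamagawaNumber ℤ_[q'] → ¬ q' ^ 2 ∣ W.conductorNorm ℤ) →
      ∀ (Dt : Literature.NumberTheory.EllipticCurves.ModularForms.ModularParametrizationData W (W.conductorNorm ℤ))
        (β : ℤ) (ι : K →+* ℂ) (d₁ : Literature.NumberTheory.EllipticCurves.KolyvaginHeegnerData Dt β ι 1),
        ¬ IsOfFinAddOrder d₁.derivedPoint →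
      ∀ (q : ℕ) [Fact q.Prime], q ∣ W.conductorNorm ℤ → ¬ q ^ 2 ∣ W.conductorNorm ℤ → q ≠ p →
      ∀ (s : ℕ), s ≤ padicValNat p ((W.baseChange ℚ_[q]).localTamagawaNumber ℤ_[q]) →
      ∀ (n : ℕ) (d : Literature.NumberTheory.EllipticCurves.KolyvaginHeegnerData Dt β ι n), Squarefree n →
        (∀ ℓ ∈ n.primeFactors, Literature.NumberTheory.EllipticCurves.Zhang2014.IsKolyvaginPrime (W.conductorNorm ℤ) W K p ℓ ∧
          s ≤ Literature.NumberTheory.EllipticCurves.Zhang2014.kolyvaginIndex W p ℓ) →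
        ∃ Q : (W.baseChange (Literature.NumberTheory.EllipticCurves.ringClassField K ι n)).toAffine.Point,
          ((p ^ s : ℕ) : ℤ) • Q = d.derivedPoint)
    (hSig' : ∀ (W : WeierstrassCurve ℚ) [W.IsElliptic] [W.IsGloballyMinimal] (N : ℕ) [NeZero N]
      (K : Type) [Field K] [NumberField K]
      (Dt : Literature.NumberTheory.EllipticCurves.ModularForms.ModularParametrizationData W N)
      (H : Literature.NumberTheory.EllipticCurves.HeegnerDatum N (NumberField.discr K)) (ι : K →+* ℂ)
      (P : (W.baseChange K).toAffine.Point),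
      ¬ W.HasCM → Literature.NumberTheory.EllipticCurves.Rank1Residual.Addv W 3 →
      Summit.BirchSwinnertonDyer.Rank1Residual.Additive.SubGss W 3 → W.analyticRank = 1 →
      W.conductorNorm ℤ = N →
      ¬ ((∃ (q : ℕ) (_ : Fact q.Prime), q ∣ N ∧ ¬ q ^ 2 ∣ N ∧
          padicValNat 3 W.tamagawaProduct ≤ padicValNat 3 ((W.baseChange ℚ_[q]).localTamagawaNumber ℤ_[q])) ∧
        (∀ (q' : ℕ) [Fact q'.Prime], q' ∣ N →
          3 ∣ (W.baseChange ℚ_[q']).localTamagawaNumber ℤ_[q'] → ¬ q' ^ 2 ∣ N) ∧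
        (∃ Dt' : Literature.NumberTheory.EllipticCurves.ModularForms.ModularParametrizationData W N, ¬ (3 : ℤ) ∣ Dt'.c)) →
      Literature.NumberTheory.EllipticCurves.IsImaginaryQuadratic K →
      Literature.NumberTheory.EllipticCurves.SatisfiesHeegnerHypothesis N K →
      (W.quadraticTwist (NumberField.discr K : ℚ)).entireLFunction 1 ≠ 0 →
      (WeierstrassCurve.Affine.Point.map ι.toRatAlgHom) P =
        Literature.NumberTheory.EllipticCurves.ModularForms.heegnerPointComplex Dt H →
      ¬ IsOfFinAddOrder P → Odd (NumberField.discr K) →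
      ∀ (s' : ℕ), s' ≤ padicValNat 3 W.tamagawaProduct + padicValNat 3 Dt.c.natAbs →
      ∀ (n : ℕ) (d : Literature.NumberTheory.EllipticCurves.KolyvaginHeegnerData Dt H.β ι n), Squarefree n →
      (∀ ℓ ∈ n.primeFactors, Literature.NumberTheory.EllipticCurves.Zhang2014.IsKolyvaginPrime N W K 3 ℓ ∧
        s' ≤ Literature.NumberTheory.EllipticCurves.Zhang2014.kolyvaginIndex W 3 ℓ) →
      Summit.BirchSwinnertonDyer.Rank1Residual.X11b.Three.Koly.PDiv d 3 s')
    (hL0 : Summit.BirchSwinnertonDyer.BirchSwinnertonDyer.Theses.RamifiedHeegnerPair.Gss2LowerAtThreeRankZero) :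
    Summit.BirchSwinnertonDyer.BirchSwinnertonDyer.Theses.RamifiedHeegnerPair.LeafRankOneUpperAtThree :=
  leafRankOneUpperAtThree_of_pubManin_of_divisibilityReading_of_sigmaOptOffRows_of_lowerRankZero hpub hD
    (sigmaOptOffRows_of_sigmaOffRows hSig') hL0

/-! ## §6 The Tamagawa-free classes: U₁ is PRINT + L₀ outright (image-free AND Manin-free) -/

/-- **U₁ on a Tamagawa-free OPTIMAL member from print + L₀ alone.** For `W/ℚ` globally minimal, non-CM, leaf Gss2 at `3`,
`r_an(W) = 1`, carrying a lattice-optimal datum `Dt` (level `N_W`) and with `3 ∤ ∏_ℓ c_ℓ(W)`: `Typed.MissingUpperBoundAt W 3`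
from the printed named facts (+ Mazur / Abbes–Ullmo / Česnavičius for `3 ∤ c(Dt)`, §3 of the sibling) and L₀ — p610955 §3
`leafRankOneUpper_three_tamFree_of_pub_of_lowerRankZero` with its Manin datum DISCHARGED. No S2, no Σ.
[cite: McCallumLMS1991, §1 Theorem (Kolyvagin)] [cite: MatarNekovar2019, Thm. 0.7 (p. 456)] [cite: Mazur1978, Cor. 4.1]
[cite: FriedbergHoffstein1995, Thm. B] [cite: GrossZagier1986, Thm. I.(6.3) and (7.3)] [cite: Miller2011LMS, Def. 1.1] -/
theorem leafRankOneUpper_three_tamFree_of_latticeOptimal_of_pub_of_lowerRankZero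
    (hGZ : ∀ (N : ℕ) [NeZero N] (W : WeierstrassCurve ℚ) (K : Type) [Field K] [NumberField K],
      gross_zagier N W K)
    (hKo : ∀ (N : ℕ) [NeZero N] (W : WeierstrassCurve ℚ) (K : Type) [Field K] [NumberField K],
      kolyvagin N W K)
    (hGZK : rank_eq_analyticRank_of_analyticRank_le_one) (hmod : hasEntireLFunction_rat)
    (hGZ73 : GrossZagier1986_thm_I_7_3)
    (hMN : MatarNekovar2019.thm07_padicValNat_card_sha_primary_add_le_of_globalDivisibility_of_irreducible)
    (hnf : exists_isNewformOf) (hFH : friedbergHoffstein_exists_heegnerField_splitDivisors_twist_ne_zero)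
    (hM : mazur_not_dvd_maninConstant_of_odd) (hAU : abbesUllmo_not_dvd_maninConstant_of_not_dvd_level)
    (hC2 : cesnavicius_not_two_dvd_maninConstant_of_two_dvd_level)
    (hL0 : Gss2LowerAtThreeRankZero)
    (W : WeierstrassCurve ℚ) [W.IsElliptic] [W.IsGloballyMinimal] [NeZero (W.conductorNorm ℤ)]
    (hCM : ¬ W.HasCM) (hadd : Addv W 3) (hsub : SubGss W 3) (hr : W.analyticRank = 1)
    (htam : ¬ 3 ∣ W.tamagawaProduct)
    (Dt : ModularParametrizationData W (W.conductorNorm ℤ))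
    (hopt : ∀ z ∈ Dt.L.lattice, ∃ w ∈ periodLattice Dt.f, z = Dt.c * w) :
    MissingUpperBoundAt W 3 :=
  leafRankOneUpper_three_tamFree_of_pub_of_lowerRankZero hGZ hKo hGZK hmod hGZ73 hMN hnf hFH hL0 W hCM hadd hsub hr htam Dt
    (not_three_dvd_c_of_latticeOptimal_of_subGss hM hAU hC2 hnf W Dt hopt hadd hsub)

/-- **U₁ at ANY leaf curve whose class has a Tamagawa-free optimal member, from print + L₀ alone** (the transported form:
`W ∼ W₀`, `W₀` globally minimal with a lattice-optimal datum and `3 ∤ ∏_ℓ c_ℓ(W₀)`; Cassels + GZK carry U₁ back to `W`).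
On the census's 9 Tamagawa-free rank-one Gss2 classes (N ≤ 5·10⁵) U₁ is therefore PRINT + L₀ with NO per-curve datum
hypothesis left (g3's p610955 §3 was image-free; this is also Manin-free). [cite: McCallumLMS1991, §1 Theorem (Kolyvagin)]
[cite: MatarNekovar2019, Thm. 0.7 (p. 456)] [cite: Mazur1978, Cor. 4.1] [cite: MilneADT2006, Thm. I.7.3]
[cite: Miller2011LMS, Def. 1.1] -/
theorem leafRankOneUpper_three_of_tamFree_optimalMember_of_pub_of_lowerRankZero
    (hGZ : ∀ (N : ℕ) [NeZero N] (W : WeierstrassCurve ℚ) (K : Type) [Field K] [NumberField K],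
      gross_zagier N W K)
    (hKo : ∀ (N : ℕ) [NeZero N] (W : WeierstrassCurve ℚ) (K : Type) [Field K] [NumberField K],
      kolyvagin N W K)
    (hGZK : rank_eq_analyticRank_of_analyticRank_le_one) (hmod : hasEntireLFunction_rat)
    (hGZ73 : GrossZagier1986_thm_I_7_3)
    (hMN : MatarNekovar2019.thm07_padicValNat_card_sha_primary_add_le_of_globalDivisibility_of_irreducible)
    (hnf : exists_isNewformOf) (hFH : friedbergHoffstein_exists_heegnerField_splitDivisors_twist_ne_zero)
    (hCassels : bsdRHS_eq_of_isIsogenous)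
    (hM : mazur_not_dvd_maninConstant_of_odd) (hAU : abbesUllmo_not_dvd_maninConstant_of_not_dvd_level)
    (hC2 : cesnavicius_not_two_dvd_maninConstant_of_two_dvd_level)
    (hL0 : Gss2LowerAtThreeRankZero)
    (W : WeierstrassCurve ℚ) [W.IsElliptic] [W.IsGloballyMinimal]
    (hCM : ¬ W.HasCM) (hadd : Addv W 3) (hsub : SubGss W 3) (hr : W.analyticRank = 1)
    (W₀ : WeierstrassCurve ℚ) [W₀.IsElliptic] [W₀.IsGloballyMinimal] [NeZero (W₀.conductorNorm ℤ)]
    (hiso : IsIsogenous W W₀) (htam₀ : ¬ 3 ∣ W₀.tamagawaProduct)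
    (D₀ : ModularParametrizationData W₀ (W₀.conductorNorm ℤ))
    (hopt₀ : ∀ z ∈ D₀.L.lattice, ∃ w ∈ periodLattice D₀.f, z = D₀.c * w) :
    MissingUpperBoundAt W 3 := by
  haveI : Fact (Nat.Prime 3) := ⟨Nat.prime_three⟩
  obtain ⟨hCM₀, hadd₀, hsub₀, hr₀⟩ := leaf_of_isIsogenous hiso hCM hadd hsub
  exact missingUpperBoundAt_of_isIsogenous_of_analyticRank_le_one hCassels hGZK hmod (le_of_eq hr) hiso
    (leafRankOneUpper_three_tamFree_of_latticeOptimal_of_pub_of_lowerRankZero hGZ hKo hGZK hmod hGZ73 hMN hnf hFH hM hAU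
      hC2 hL0 W₀ hCM₀ hadd₀ hsub₀ (hr₀.trans hr) htam₀ D₀ hopt₀)

end Summit.BirchSwinnertonDyer.BirchSwinnertonDyer.Theorems.RamifiedPairUpperBound

end
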